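import Mathlib.Algebra.QuadraticAlgebra.Basic
import Mathlib.Algebra.Field.ZMod
import Mathlib.Algebra.Group.Action.Pointwise.Finset
import Mathlib.GroupTheory.SpecificGroups.Alternating.Simple
import Mathlib.LinearAlgebra.Projectivization.Action
import Mathlib.LinearAlgebra.Projectivization.Cardinality
import HarnessLib

/-!
# The exceptional isomorphism `A₆ ≅ PSL₂(𝔽₉)`, I: Wilson's labelling

The computational heart of `A₆ ≅ PSL₂(𝔽₉)` (`A₁(9) ≅ A₆`, one of the three coincidences between
groups of Lie type and alternating groups, Gorenstein, *Finite Simple Groups*, (2.7)), following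
Wilson, *The Finite Simple Groups*, §3.3.5: a concrete model `AltSixPSL.F9 = 𝔽₃[i]` of `𝔽₉`, the
`S₆`-set `AltSixPSL.B` of bisections of six letters, Wilson's labelling `AltSixPSL.e : B → ℙ¹(𝔽₉)`
and the theorem `AltSixPSL.exists_sl_of_mem_alternatingGroup` that every even permutation acts on
the bisections as an element of `SL₂(𝔽₉)` acts on `ℙ¹(𝔽₉)`. The isomorphism itself is assembled in
`Literature/GroupTheory/SpecificGroups/AlternatingSixPSL2Nine.lean`.

## The proof (Wilson, *The Finite Simple Groups*, §3.3.5)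

Label the ten points of the projective line `ℙ¹(𝔽₉)` by the ten partitions of six letters into
two triples ("bisections"; here `B`, a bisection being represented by its block containing `0`):
`∞ ↔ (012|345)`, `0 ↔ (045|123)`, and the rest forced by letting the `3`-cycles `(0 1 2)` and
`(3 4 5)` act as `z ↦ z + 1` and `z ↦ z + i` (`AltSixPSL.e`, Wilson's table with letters `0,…,5`).
Under this labelling every even permutation acts as an element of `PSL₂(9)`, and odd permutations
act as semilinear maps (`S₆ ≅ PΣL₂(9)`; Wilson: "the map `z ↦ z³` corresponds to the transposition
`(5,6)`"). We check the latter directly: for each of the fifteen transpositions `(x y)` an explicit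
`M_{xy} ∈ SL₂(𝔽₉)` with `e((x y)·b) = M_{xy} · \overline{e(b)}` for all ten `b` (`e_swap_smul`,
`150` identities in `ℙ¹(𝔽₉)` verified by `decide`); composing two of them, a product of two
transpositions acts as `M_{xy} \overline{M_{zw}} ∈ SL₂(𝔽₉)`, so (writing an even permutation as a
product of an even number of transpositions, as in Mathlib's
`Equiv.Perm.closure_three_cycles_eq_alternating`) all of `A₆` acts through `PSL₂(𝔽₉)`
(`exists_sl_of_mem_alternatingGroup`, this file). Part II then concludes: `A₆` is simple
(Mathlib `alternatingGroup.isSimpleGroup`) and acts non-trivially, `PSL₂(𝔽₉)` acts faithfully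
(Mathlib `Matrix.ProjectiveSpecialLinearGroup.toPermHom_injective`), so there is a monomorphism
`A₆ →* PSL₂(𝔽₉)` between groups of order `360`, an isomorphism — Wilson's closing count.

Design: `𝔽₉` is Mathlib's computable `QuadraticAlgebra (ZMod 3) (-1) 0` behind a type synonym,
`ℙ¹(𝔽₉)` is Mathlib's `Projectivization` with the Mathlib actions of `SL₂`/`PSL₂`
(`Mathlib.LinearAlgebra.Projectivization.Action`); only a decidable equality on `ℙ¹(𝔽₉)`
(cross-multiplication) is added so that the finitely many identities are kernel computations.

## Not here

The outer automorphism of `S₆` / `S₆ ≅ PΣL₂(9) ≇ PGL₂(9)`, `M₁₀`, and the other exceptional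
isomorphisms `A₅ ≅ PSL₂(4) ≅ PSL₂(5)`, `A₈ ≅ PSL₄(2)` (Wilson §3.3.5, Gorenstein (2.7)).

## References

* R. A. Wilson, *The Finite Simple Groups*, GTM 251, Springer 2009, §3.3.5 "The isomorphism
  `PSL₂(9) ≅ A₆`", p. 53. [Wilson2009]
* D. Gorenstein, *Finite Simple Groups*, Plenum 1982, §2.1 (2.7). [Gorenstein1982]
-/

open scoped LinearAlgebra.Projectivization MatrixGroups Pointwise

namespace Literature.GroupTheory.SpecificGroups

namespace AltSixPSL

/-! ### The field with nine elements and its projective line -/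

/-- `𝔽₉ = 𝔽₃[i]`, `i² = -1`: a type synonym of Mathlib's (computable)
`QuadraticAlgebra (ZMod 3) (-1) 0`. [folklore] -/
def F9 : Type := QuadraticAlgebra (ZMod 3) (-1) 0

/-- `𝔽₃[i]` is a field since `X² + 1` has no root in `𝔽₃` (Mathlib's `QuadraticAlgebra` field
structure). [folklore] -/
instance instFieldF9 : Field F9 :=
  haveI : Fact (∀ r : ZMod 3, r ^ 2 ≠ -1 + 0 * r) := ⟨by decide⟩
  inferInstanceAs (Field (QuadraticAlgebra (ZMod 3) (-1) 0))

/-- Decidable equality of `𝔽₉` (componentwise). [folklore] -/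
instance instDecidableEqF9 : DecidableEq F9 :=
  inferInstanceAs (DecidableEq (QuadraticAlgebra (ZMod 3) (-1) 0))

/-- `𝔽₉` is finite (enumerated through `(re, im)`). [folklore] -/
instance instFintypeF9 : Fintype F9 :=
  Fintype.ofEquiv _ (QuadraticAlgebra.equivProd (-1 : ZMod 3) 0).symm

/-- The Frobenius `x + y i ↦ x - y i = (x + y i)³` of `𝔽₉` as a star structure (Mathlib's `star` on
`QuadraticAlgebra`). [folklore] -/
instance instStarRingF9 : StarRing F9 :=
  inferInstanceAs (StarRing (QuadraticAlgebra (ZMod 3) (-1) 0))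

/-- `|𝔽₉| = 9`. [folklore] -/
theorem card_F9 : Fintype.card F9 = 9 := rfl

/-- The element `x + y·i` of `𝔽₉` (`x y : 𝔽₃`). [folklore] -/
def el (x y : ZMod 3) : F9 := (⟨x, y⟩ : QuadraticAlgebra (ZMod 3) (-1) 0)

/-- `P = ℙ¹(𝔽₉)`, Mathlib's projectivization of `𝔽₉²`. [folklore] -/
abbrev P : Type := ℙ F9 (Fin 2 → F9)

/-- On `𝔽₉²`, `[v] = [w] ↔ v₀ w₁ = v₁ w₀`. [folklore] -/
theorem mk_eq_mk_iff_mul_eq_mul (v w : Fin 2 → F9) (hv : v ≠ 0) (hw : w ≠ 0) :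
    Projectivization.mk F9 v hv = Projectivization.mk F9 w hw ↔ v 0 * w 1 = v 1 * w 0 := by
  rw [Projectivization.mk_eq_mk_iff']
  refine ⟨?_, fun h => ?_⟩
  · rintro ⟨a, rfl⟩
    simp only [Pi.smul_apply, smul_eq_mul]
    ring
  by_cases h0 : w 0 = 0
  · have h1 : w 1 ≠ 0 := by
      intro h1; apply hw; funext i; fin_cases i
      · exact h0
      · exact h1
    have hv0 : v 0 = 0 := by
      have : v 0 * w 1 = 0 := by rw [h, h0, mul_zero]
      exact (mul_eq_zero.mp this).resolve_right h1
    refine ⟨v 1 / w 1, ?_⟩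
    funext i; fin_cases i
    · simp [h0, hv0]
    · simp [div_mul_cancel₀ _ h1]
  · refine ⟨v 0 / w 0, ?_⟩
    funext i; fin_cases i
    · simp [div_mul_cancel₀ _ h0]
    · simp only [Pi.smul_apply, smul_eq_mul, Fin.mk_one, Fin.isValue]
      rw [div_mul_eq_mul_div, h, mul_div_assoc, div_self h0, mul_one]

/-- Decidable equality on `ℙ¹(𝔽₉)` through cross-multiplication, so that identities between explicit
projective (semi)linear transformations are kernel computations. [folklore] -/
instance instDecidableEqP : DecidableEq P :=
  @Quotient.decidableEq _ (projectivizationSetoid F9 (Fin 2 → F9)) fun a b =>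
    decidable_of_iff (a.1 0 * b.1 1 = a.1 1 * b.1 0)
      ((mk_eq_mk_iff_mul_eq_mul a.1 b.1 a.2 b.2).symm.trans Quotient.eq'')

/-- The point `∞ = [1 : 0]`. [folklore] -/
def inf : P := Projectivization.mk F9 ![1, 0] fun h => one_ne_zero (congr_fun h 0)

/-- The finite point `z = [z : 1]`. [folklore] -/
def fin (z : F9) : P := Projectivization.mk F9 ![z, 1] fun h => one_ne_zero (congr_fun h 1)

/-- Coordinatewise Frobenius `v ↦ v̄`, semilinear over the Frobenius `starRingEnd 𝔽₉`. [folklore] -/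
def conjV : (Fin 2 → F9) →ₛₗ[starRingEnd F9] (Fin 2 → F9) where
  toFun v i := star (v i)
  map_add' v w := by funext i; simp
  map_smul' c v := by funext i; simp [starRingEnd_apply]

/-- `conjV v i = star (v i)`. [folklore] -/
theorem conjV_apply (v : Fin 2 → F9) (i : Fin 2) : conjV v i = star (v i) := rfl

/-- `conjV` is injective. [folklore] -/
theorem conjV_injective : Function.Injective conjV := fun v w h => by
  funext i; simpa [conjV_apply] using congr_fun h i

/-- The Frobenius collineation `[v] ↦ [v̄]` of `ℙ¹(𝔽₉)` (Mathlib `Projectivization.map`).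
[folklore] -/
def frob : P → P := Projectivization.map conjV conjV_injective

/-- `frob [v] = [v̄]`. [folklore] -/
theorem frob_mk (v : Fin 2 → F9) (hv : v ≠ 0) :
    frob (Projectivization.mk F9 v hv) =
      Projectivization.mk F9 (conjV v) (by simpa using conjV_injective.ne hv) := rfl

/-- Frobenius is an involution of `ℙ¹(𝔽₉)`. [folklore] -/
theorem frob_frob (p : P) : frob (frob p) = p := by
  induction p using Projectivization.ind with
  | h v hv => rw [frob_mk, frob_mk]; congr 1; funext i; simp [conjV_apply]

/-- `frob (g • p) = ḡ • frob p`: Frobenius normalises `SL₂(𝔽₉)` acting on `ℙ¹(𝔽₉)`. [folklore] -/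
theorem frob_smul (g : SL(2, F9)) (p : P) :
    frob (g • p) = Matrix.SpecialLinearGroup.map (starRingEnd F9) g • frob p := by
  induction p using Projectivization.ind with
  | h v hv =>
    rw [Projectivization.smul_mk, frob_mk, frob_mk, Projectivization.smul_mk]
    congr 1
    funext i
    change star (Matrix.mulVec g.1 v i) =
      Matrix.mulVec ((starRingEnd F9).mapMatrix g.1) (fun j => star (v j)) i
    rw [← starRingEnd_apply, RingHom.map_mulVec, RingHom.mapMatrix_apply]
    rfl

/-! ### Bisections of six letters and Wilson's labelling -/

/-- The ten partitions of `Fin 6` into two triples, each represented by its block containing `0`.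
[folklore] -/
def B : Type := {s : Finset (Fin 6) // s.card = 3 ∧ (0 : Fin 6) ∈ s}

/-- Decidable equality of bisections. [folklore] -/
instance instDecidableEqB : DecidableEq B :=
  inferInstanceAs (DecidableEq {s : Finset (Fin 6) // s.card = 3 ∧ (0 : Fin 6) ∈ s})

/-- Bisections form a finite type. [folklore] -/
instance instFintypeB : Fintype B :=
  inferInstanceAs (Fintype {s : Finset (Fin 6) // s.card = 3 ∧ (0 : Fin 6) ∈ s})

/-- The block containing `0` of the partition `{s, sᶜ}`. [folklore] -/
def nrm (s : Finset (Fin 6)) : Finset (Fin 6) := if (0 : Fin 6) ∈ s then s else sᶜ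

/-- `0 ∈ nrm s`. [folklore] -/
theorem zero_mem_nrm (s : Finset (Fin 6)) : (0 : Fin 6) ∈ nrm s := by
  unfold nrm; split_ifs with h
  · exact h
  · exact Finset.mem_compl.mpr h

/-- `nrm` of a triple is a triple. [folklore] -/
theorem card_nrm {s : Finset (Fin 6)} (hs : s.card = 3) : (nrm s).card = 3 := by
  unfold nrm; split_ifs
  · exact hs
  · rw [Finset.card_compl, hs]; rfl

/-- `nrm s = s` if `0 ∈ s`. [folklore] -/
theorem nrm_of_mem {s : Finset (Fin 6)} (h : (0 : Fin 6) ∈ s) : nrm s = s := if_pos h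

/-- `nrm s = sᶜ` if `0 ∉ s`. [folklore] -/
theorem nrm_of_not_mem {s : Finset (Fin 6)} (h : (0 : Fin 6) ∉ s) : nrm s = sᶜ := if_neg h

/-- `{s, sᶜ}` and `{sᶜ, s}` have the same block containing `0`. [folklore] -/
theorem nrm_compl (s : Finset (Fin 6)) : nrm sᶜ = nrm s := by
  by_cases h : (0 : Fin 6) ∈ s
  · rw [nrm_of_not_mem (Finset.notMem_compl.mpr h), nrm_of_mem h, compl_compl]
  · rw [nrm_of_mem (Finset.mem_compl.mpr h), nrm_of_not_mem h]

/-- Permutations commute with complements. [folklore] -/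
theorem smul_finset_compl (σ : Equiv.Perm (Fin 6)) (s : Finset (Fin 6)) : σ • sᶜ = (σ • s)ᶜ := by
  rw [Finset.compl_eq_univ_sdiff, Finset.smul_finset_sdiff, Finset.smul_finset_univ,
    Finset.compl_eq_univ_sdiff]

/-- The partition `{σ s, σ sᶜ}` only depends on the partition `{s, sᶜ}`. [folklore] -/
theorem nrm_smul_nrm (σ : Equiv.Perm (Fin 6)) (s : Finset (Fin 6)) :
    nrm (σ • nrm s) = nrm (σ • s) := by
  by_cases h : (0 : Fin 6) ∈ s
  · rw [nrm_of_mem h]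
  · rw [nrm_of_not_mem h, smul_finset_compl, nrm_compl]

/-- `S₆` acts on bisections: `σ • {s, sᶜ} = {σ s, σ sᶜ}`. [folklore] -/
instance instMulActionB : MulAction (Equiv.Perm (Fin 6)) B where
  smul σ b :=
    ⟨nrm (σ • b.1), card_nrm (by rw [Finset.card_smul_finset]; exact b.2.1), zero_mem_nrm _⟩
  one_smul b := Subtype.ext (by
    change nrm ((1 : Equiv.Perm (Fin 6)) • b.1) = b.1
    rw [one_smul, nrm_of_mem b.2.2])
  mul_smul σ τ b := Subtype.ext (by
    change nrm ((σ * τ) • b.1) = nrm (σ • nrm (τ • b.1))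
    rw [nrm_smul_nrm, mul_smul])

/-- There are ten bisections. [folklore] -/
theorem card_B : Fintype.card B = 10 := by decide +kernel

/-- The bisection `(012|345)`. [folklore] -/
def b₀ : B := ⟨{0, 1, 2}, by decide⟩

/-- Wilson's labelling of the bisections by the points of `ℙ¹(𝔽₉)`: `∞ ↔ (012|345)`,
`0 ↔ (045|123)`, and `(0 1 2) ↦ z + 1`, `(3 4 5) ↦ z + i` (here on the block containing `0`;
junk value `∞` on non-triples). [cite: Wilson2009, §3.3.5] -/
def eFin (s : Finset (Fin 6)) : P :=
  if s = {0, 1, 2} then inf else if s = {0, 1, 3} then fin (el 2 0) else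
  if s = {0, 1, 4} then fin (el 2 1) else if s = {0, 1, 5} then fin (el 2 2) else
  if s = {0, 2, 3} then fin (el 1 0) else if s = {0, 2, 4} then fin (el 1 1) else
  if s = {0, 2, 5} then fin (el 1 2) else if s = {0, 3, 4} then fin (el 0 2) else
  if s = {0, 3, 5} then fin (el 0 1) else if s = {0, 4, 5} then fin (el 0 0) else inf

/-- The labelling `e : B → ℙ¹(𝔽₉)`. [cite: Wilson2009, §3.3.5] -/
def e (b : B) : P := eFin b.1

/-- The labelling is injective (checked by `decide`). [cite: Wilson2009, §3.3.5] -/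
theorem e_injective : Function.Injective e := by
  have : ∀ b b' : B, e b = e b' → b = b' := by decide +kernel
  exact fun b b' h => this b b' h

/-- The matrices `M x y ∈ SL₂(𝔽₉)` (`x ≠ y`; the diagonal is unused) of the semilinear maps
`v ↦ M x y · v̄` realising the transpositions `(x y)` on `ℙ¹(𝔽₉)` (each is determined by the
labelling up to sign; found by exhaustive search); e.g. `M 4 5 = 1`, i.e. `(4 5)` is the Frobenius
`z ↦ z³` (Wilson's "(5,6)"). [cite: Wilson2009, §3.3.5] -/
def Mtab : Fin 6 → Fin 6 → Matrix (Fin 2) (Fin 2) F9 :=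
  ![![1, !![el 0 1, el 0 2; el 0 0, el 0 2], !![el 0 1, el 0 1; el 0 0, el 0 2],
      !![el 0 0, el 0 1; el 0 1, el 0 0], !![el 1 0, el 0 0; el 0 2, el 1 0],
      !![el 1 0, el 0 0; el 0 1, el 1 0]],
    ![!![el 0 1, el 0 2; el 0 0, el 0 2], 1, !![el 0 1, el 0 0; el 0 0, el 0 2],
      !![el 0 1, el 0 0; el 0 1, el 0 2], !![el 1 2, el 0 1; el 0 2, el 1 1],
      !![el 1 1, el 0 2; el 0 1, el 1 2]],
    ![!![el 0 1, el 0 1; el 0 0, el 0 2], !![el 0 1, el 0 0; el 0 0, el 0 2], 1,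
      !![el 0 1, el 0 0; el 0 2, el 0 2], !![el 1 1, el 0 1; el 0 2, el 1 2],
      !![el 1 2, el 0 2; el 0 1, el 1 1]],
    ![!![el 0 0, el 0 1; el 0 1, el 0 0], !![el 0 1, el 0 0; el 0 1, el 0 2],
      !![el 0 1, el 0 0; el 0 2, el 0 2], 1, !![el 1 0, el 0 1; el 0 0, el 1 0],
      !![el 1 0, el 0 2; el 0 0, el 1 0]],
    ![!![el 1 0, el 0 0; el 0 2, el 1 0], !![el 1 2, el 0 1; el 0 2, el 1 1],
      !![el 1 1, el 0 1; el 0 2, el 1 2], !![el 1 0, el 0 1; el 0 0, el 1 0], 1,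
      !![el 1 0, el 0 0; el 0 0, el 1 0]],
    ![!![el 1 0, el 0 0; el 0 1, el 1 0], !![el 1 1, el 0 2; el 0 1, el 1 2],
      !![el 1 2, el 0 2; el 0 1, el 1 1], !![el 1 0, el 0 2; el 0 0, el 1 0],
      !![el 1 0, el 0 0; el 0 0, el 1 0], 1]]

/-- All `M x y` have determinant `1` (checked by `decide`). [folklore] -/
theorem det_Mtab : ∀ x y : Fin 6, (Mtab x y).det = 1 := by decide +kernel

/-- `M x y` as an element of `SL₂(𝔽₉)`. [cite: Wilson2009, §3.3.5] -/
def M (x y : Fin 6) : SL(2, F9) := ⟨Mtab x y, det_Mtab x y⟩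

/-- **The fifteen transpositions act on the ten bisections as the semilinear maps `v ↦ M v̄` act on
`ℙ¹(𝔽₉)`** ("an odd permutation of `S₆` realises a field automorphism of `𝔽₉`"): the `150`
identities `e((x y) • b) = M x y • frob (e b)`, checked by `decide`. [cite: Wilson2009, §3.3.5] -/
theorem e_swap_smul :
    ∀ x y : Fin 6, x ≠ y → ∀ b : B, e (Equiv.swap x y • b) = M x y • frob (e b) := by
  decide +kernel

/-- A product of two transpositions acts on the bisections as `M_{xy} M̄_{zw} ∈ SL₂(𝔽₉)` acts on
`ℙ¹(𝔽₉)`. [cite: Wilson2009, §3.3.5] -/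
theorem e_swap_mul_swap_smul {x y z w : Fin 6} (hxy : x ≠ y) (hzw : z ≠ w) (b : B) :
    e ((Equiv.swap x y * Equiv.swap z w) • b) =
      (M x y * Matrix.SpecialLinearGroup.map (starRingEnd F9) (M z w)) • e b := by
  rw [mul_smul, e_swap_smul x y hxy, e_swap_smul z w hzw, frob_smul, frob_frob, ← mul_smul]

/-- A product of `2n` transpositions acts on the bisections as an element of `SL₂(𝔽₉)` acts on
`ℙ¹(𝔽₉)`. [cite: Wilson2009, §3.3.5] -/
theorem exists_sl_of_swap_list : ∀ (n : ℕ) (l : List (Equiv.Perm (Fin 6))),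
    (∀ g ∈ l, g.IsSwap) → l.length = 2 * n →
      ∃ g : SL(2, F9), ∀ b : B, e (l.prod • b) = g • e b := by
  intro n
  induction n with
  | zero =>
    intro l _ hn
    exact ⟨1, fun b => by rw [List.length_eq_zero_iff.1 hn, List.prod_nil, one_smul, one_smul]⟩
  | succ n ih =>
    intro l hl hn
    rw [Nat.mul_succ] at hn
    obtain ⟨s, l, rfl⟩ := l.exists_of_length_succ hn
    rw [List.length_cons, Nat.succ_inj] at hn
    obtain ⟨t, l, rfl⟩ := l.exists_of_length_succ hn
    rw [List.length_cons, Nat.succ_inj] at hn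
    obtain ⟨g, hg⟩ := ih l (fun g hg => hl g (by simp [hg])) hn
    obtain ⟨x, y, hxy, hs⟩ := hl s (by simp)
    obtain ⟨z, w, hzw, ht⟩ := hl t (by simp)
    subst hs ht
    refine ⟨M x y * Matrix.SpecialLinearGroup.map (starRingEnd F9) (M z w) * g, fun b => ?_⟩
    rw [List.prod_cons, List.prod_cons, ← mul_assoc, mul_smul, e_swap_mul_swap_smul hxy hzw, hg,
      ← mul_smul]

/-- **Every even permutation of six letters acts on the ten bisections as an element of `SL₂(𝔽₉)`
acts on `ℙ¹(𝔽₉)`** (under Wilson's labelling). [cite: Wilson2009, §3.3.5] -/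
theorem exists_sl_of_mem_alternatingGroup {σ : Equiv.Perm (Fin 6)}
    (hσ : σ ∈ alternatingGroup (Fin 6)) : ∃ g : SL(2, F9), ∀ b : B, e (σ • b) = g • e b := by
  obtain ⟨l, rfl, hl⟩ := Equiv.Perm.truncSwapFactors σ
  obtain ⟨n, hn⟩ := (Equiv.Perm.prod_list_swap_mem_alternatingGroup_iff_even_length hl).1 hσ
  rw [← two_mul] at hn
  exact exists_sl_of_swap_list n l hl hn

end AltSixPSL

end Literature.GroupTheory.SpecificGroups
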